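import Mathlib.AlgebraicGeometry.Morphisms.Smooth
import Mathlib.AlgebraicGeometry.Morphisms.ClosedImmersion
import Mathlib.FieldTheory.Perfect
import Mathlib.Algebra.Field.ZMod
import Mathlib.FieldTheory.Finite.Basic
import Literature.AlgebraicGeometry.Resolution.ResolutionOfSingularities
import Literature.AlgebraicGeometry.Hironaka2017.S01Introduction.R020bMainTheoremIntro
import Summits.ResolutionOfSingularities.ResolutionOfSingularities.Theses.Descent
import HarnessLib

/-!
# RUNG B of LADDER-RESOLUTION (D-0089): the bridge «Hironaka 2017's embedded resolution over PERFECT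
# fields ⇒ the summit conjunct `ResolutionInChar p`» — OUR statements, decomposed `B0 ∧ B1 ∧ B2`

Cell `res-hironaka` (run/shared/lean/pub/res-hironaka/), text of record `plan/RUNG-B.md` v0.1 (res-plan-1, adopting
res-lit-3's `lit/RUNG-B-LIT.md` §4 decomposition and `lit/res-lit-3/RungB_Sketch.lean`); landing place ruled by
director-resolution 2026-08-26T15:23:05Z: SUMMIT-SIDE, this file, `--kind definition --supports
stmt-ResolutionOfSingularities-0549`. Typed by the row-020 typer (res-type-020), owner of the I-ERS interface.

HONEST FRAMING. Every declaration below is OURS (a campaign statement) or pure logic; NOTHING here is a statement of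
H. Hironaka's manuscript *Resolution of singularities in positive characteristics* (2017-03-23, [Hironaka2017], lit key
`paper:url-3343fd9e678b`) and nothing here asserts that any statement of that manuscript holds. The manuscript's own
§1 sentence (p.3 l.4–7) is TYPED, not asserted, in
`Literature.AlgebraicGeometry.Hironaka2017.S01Introduction` (`U03_1` as printed «over any base field»,
`U03_1_ours` = `MainClaimPerfect` read with the standing convention §2 p.4 l.22–24 «perfect base field K»); this file
only PRICES what the summit would still be owed if that candidate held: the conditional `RungB p`, split as

* `ERSToEmbeddedSmoothRes p` (GAP row G8-a): typed §1 claim over perfect `K` (per-`p` slice `HironakaERSPerfect p`)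
  ⇒ its non-embedded consequence `EmbeddedSmoothResPerfect p` (composite of blow-ups proper, final strict transform a
  resolution; tree pattern `Literature.AlgebraicGeometry.Resolution.hasResolution_of_isEmbeddedTransform`);
* `B0 p` : `EmbeddedSmoothResPerfect p → PerfectRes p` (Chow; tree pattern `EmbeddedToNonembedded`, stmt-14701, proved);
* `B1 p` : `PrimeFieldRes p → FgLevelRes p` (spreading out + generic fibre = the manuscript's §17 p.89 l.60–62 device;
  PROVED in the tree in this idiom: `Theorems.stub_levelResolution`, whose perfect-field hypothesis is used only at `ZMod p`);
* `B2 p` : `FgLevelRes p → ResolutionInChar p` — THE RESIDUAL DEBT: descent from finitely generated to ALL ground fields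
  of characteristic `p`; NOT IN PRINT (the manuscript offers p.89 l.59–62 and Galois descent for algebraic extensions of a
  perfect `K`, p.90 l.5–11, only); it is the open part of the EXISTING crux `Theses.Descent.DescentPerfectToAll`
  (stmt-ResolutionOfSingularities-0549, shared by 15 routes) — cited BY NAME, never re-filed, never a Literature fact;
  bounded by the catalogued barriers `Literature.Barriers.ResolutionOfSingularities.InseparableBaseChangeResolution`,
  `RegularNotGeometricallyRegular`, `InseparableBaseChange`, `FrobeniusTwistResolution`.

Pure-logic assemblies: `bridge` (`B0 → B1 → B2 → RungB`), `rungB_of_b0_of_descentAt` (`B0` + the `p`-slice of stmt-0549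
suffice), `resolutionInChar_of_hironakaERSPerfect` (the whole chain from the typed candidate), and the anchors
`descentPerfectToAll_iff` (stmt-0549 ↔ `∀ p prime, PerfectRes p → ResolutionInChar p`, by `Iff.rfl`),
`mainClaimPerfect_iff` (typed §1 claim ↔ `∀ p prime, HironakaERSPerfect p`, by `Iff.rfl`),
`perfectRes_of_resolutionInChar`, `primeFieldRes_of_perfectRes`, `b2_imp_descentAt` (given `B1`). No `sorry`; axioms standard.
Nomenclature of the director's ruling: `HironakaERSWeak` ≙ `EmbeddedSmoothResPerfect`, `ResolutionInCharPerfect` ≙ `PerfectRes`.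

## References
* plan/RUNG-B.md v0.1 §2–§3, lit/RUNG-B-LIT.md §4 (res-hironaka cell files; OURS).
* H. Hironaka, ms. 2017-03-23, §1 p.3 l.4–19; §2 p.4 l.22–24; §17 p.89 l.59–62, p.90 l.5–11 — quoted for scope only,
  under adjudication, not cited as fact. [Hironaka2017]
* No published reduction «resolution over perfect (or finitely generated) fields ⇒ resolution over ALL fields of
  characteristic `p`» is known to the cell (lit/RUNG-B-LIT.md §2; GAP-LEDGER rows R25/G8-e). Docstring revision
  2026-08-26 (lane-A reading res-L1-ref-a1 16:54:14Z, adopted): the earlier tag «[cite: Temkin2008, Question 3.3.3]»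
  on `B2` is WITHDRAWN — Temkin's Question 3.3.3 (arXiv math/0703678, p.17) asks whether a T-supported blow-up of a
  special rig-regular formal scheme is locally algebraizable, which would reduce desingularization of quasi-excellent
  schemes of characteristic `p` to schemes of finite type over fields `k(x)`; it is NOT a statement about the
  perfect/finitely-generated ⇒ all-ground-fields step and is no longer cited for it here. No Lean content changed.
-/

noncomputable section

set_option linter.dupNamespace false -- mandated namespace of this single-conjunct summit

open _root_.CategoryTheory _root_.AlgebraicGeometry
open Literature.AlgebraicGeometry.Resolution

namespace Summit.ResolutionOfSingularities.ResolutionOfSingularities.Theorems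

/-! ## The five resolution predicates (all `Prop`, all OURS) -/

/-- OURS (not a statement of the manuscript). Resolution — weak form `Scheme.HasResolution` (proper birational
`X' → X`, `X'` regular) — for every reduced separated scheme of finite type over every PERFECT field of
characteristic `p`: the antecedent of the crux `Theses.Descent.DescentPerfectToAll` (stmt-0549) at `p`
(`descentPerfectToAll_iff`); the director's `ResolutionInCharPerfect`. [folklore] -/
def PerfectRes (p : ℕ) : Prop :=
  ∀ (k : Type) [Field k] [CharP k p] [PerfectField k] (X : Scheme.{0}) (f : X ⟶ Spec (.of k)),
    IsSeparated f → LocallyOfFiniteType f → QuasiCompact f → IsReduced X → Scheme.HasResolution X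

/-- OURS. Resolution over the PRIME field `ZMod p` only (the manuscript's own choice of base field: §2 p.4 l.24
«In particular we may choose K = Z/pZ»; §17 p.89 l.59–60 «the base field K is always assumed to be a finite field
or Z/pZ» — quoted for scope, not asserted). [folklore] -/
def PrimeFieldRes (p : ℕ) [Fact p.Prime] : Prop :=
  ∀ (X : Scheme.{0}) (f : X ⟶ Spec (.of (ZMod p))),
    IsSeparated f → LocallyOfFiniteType f → QuasiCompact f → IsReduced X → Scheme.HasResolution X

/-- OURS. Resolution over every subfield `L = closure t` FINITELY GENERATED over the prime field of a field `k` of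
characteristic `p`, in the idiom of the PROVED tree lemma `Theorems.stub_levelResolution`
(DescentDescentPerfectToAllLevelResolution.lean). [folklore] -/
def FgLevelRes (p : ℕ) : Prop :=
  ∀ (k : Type) [Field k] [CharP k p] (L : Subfield k) (t : Finset k),
    L = Subfield.closure (↑t : Set k) →
      ∀ (Z : Scheme.{0}) (g : Z ⟶ Spec (.of L)),
        IsSeparated g → LocallyOfFiniteType g → QuasiCompact g → IsReduced Z → Scheme.HasResolution Z

/-- OURS — the WEAK, NON-EMBEDDED CONSEQUENCE-SHAPE of the manuscript's §1 claim over perfect fields that the bridge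
consumes (the director's `HironakaERSWeak`): for `X` integral, closed in a smooth irreducible separated `Z` of finite
type over a perfect field `K` of characteristic `p`, `X` has a resolution (`Scheme.HasResolution`). Deriving it from
the typed candidate `HironakaERSPerfect p` (§1 p.3 l.4–19 read with §2 p.4 l.22–24) is `ERSToEmbeddedSmoothRes p`
(GAP row G8-a). This is NOT a statement of the manuscript and is not asserted; it carries the claim tag only because
its content is the consequence-shape of a claim under review. [claim: Hironaka2017, status: under-review] -/
def EmbeddedSmoothResPerfect (p : ℕ) : Prop :=
  ∀ (K : Type) [Field K] [CharP K p] [PerfectField K] (Z X : Scheme.{0})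
    (g : Z ⟶ Spec (.of K)) (i : X ⟶ Z),
    IsSeparated g → LocallyOfFiniteType g → QuasiCompact g → Smooth g → IrreducibleSpace Z →
      IsClosedImmersion i → IsIntegral X → Scheme.HasResolution X

/-- The per-`p` slice of the TYPED §1 candidate read with §2's perfect `K`
(`Literature.AlgebraicGeometry.Hironaka2017.S01Introduction.MainClaimPerfect` = `U03_1_ours`, p.3 l.4–7 with p.4
l.22–24): for every perfect field `K` of characteristic `p`, every smooth irreducible quasi-compact `Z → Spec K` and
every closed subscheme `X ⊂ Z` (ideal sheaf), an ERS of `X ⊂ Z` exists (`S01Introduction.HasERS`: finitely many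
blow-ups in smooth irreducible centres inside the singular loci of the successive strict transforms, final strict
transform regular). A CANDIDATE under adjudication, consumed only as a hypothesis; `mainClaimPerfect_iff` records that
the typed decl is exactly `∀ p prime` of this slice. [claim: Hironaka2017, status: under-review] -/
def HironakaERSPerfect (p : ℕ) : Prop :=
  ∀ (K : Type) [Field K] [CharP K p] [PerfectField K]
    (Z : Scheme.{0}) [IrreducibleSpace Z] (f : Z ⟶ Spec (.of K)) [Smooth f] [QuasiCompact f]
    (X : Z.IdealSheafData), Literature.AlgebraicGeometry.Hironaka2017.S01Introduction.HasERS f X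

/-- The typed §1 candidate (perfect-`K` reading) is literally the conjunction over primes of its per-`p` slices.
[folklore] -/
theorem mainClaimPerfect_iff :
    Literature.AlgebraicGeometry.Hironaka2017.S01Introduction.MainClaimPerfect.{0} ↔
      ∀ p : ℕ, p.Prime → HironakaERSPerfect p :=
  Iff.rfl

/-! ## The links (all `Prop`, all OURS) -/

/-- OURS, GAP row G8-a of plan/RUNG-B.md §5: the typed §1 ERS claim over perfect `K` implies its non-embedded
consequence-shape — «the composite of the blow-ups is proper (`Stacks02NS_holds`), birational onto the integral `X`
because every centre lies in the singular locus of a strict transform, and the regular final strict transform is a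
resolution (`hasResolution_of_isEmbeddedTransform` pattern)». Expected provable from the tree; stated, not proved,
here. [folklore] -/
def ERSToEmbeddedSmoothRes (p : ℕ) : Prop := HironakaERSPerfect p → EmbeddedSmoothResPerfect p

/-- OURS, B0 of plan/RUNG-B.md §2: embedded-over-perfect ⇒ `PerfectRes` (Chow's lemma: an integral separated `X` of
finite type is dominated properly and birationally by a closed subscheme of a projective space, a smooth irreducible
ambient; reduced ⇒ integral by components, `Theses.Descent.DescentReducedToIntegral_holds`; tree pattern
`EmbeddedToNonembedded`, stmt-14701, proved). Expected FOLLOWS (GAP row G8-b); stated, not proved, here. [folklore] -/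
def B0 (p : ℕ) : Prop := EmbeddedSmoothResPerfect p → PerfectRes p

/-- OURS, B1 of plan/RUNG-B.md §2: prime field ⇒ every finitely generated field (spreading out over an
`𝔽_p`-variety and passing to the generic fibre — the kernel form of the manuscript's §17 sentence p.89 l.60–62 «When the
K has transcendence degree d we can reformulate the resolution problem to the case of dimension d + dim Z», quoted not
asserted). PROVED in the tree in this idiom (`Theorems.stub_levelResolution`, which instantiates its perfect-field
hypothesis only at `ZMod p`); GAP row G8-c. Stated, not proved, here. [folklore] -/
def B1 (p : ℕ) [Fact p.Prime] : Prop := PrimeFieldRes p → FgLevelRes p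

/-- OURS, B2 of plan/RUNG-B.md §2 — THE RESIDUAL DEBT: finitely generated fields ⇒ ALL fields of characteristic `p`.
NOT IN PRINT to the cell's knowledge (lit/RUNG-B-LIT.md §2: no published perfect/finitely-generated ⇒ all-fields
reduction; the manuscript is silent); the open part of crux `Theses.Descent.DescentPerfectToAll` (stmt-0549; with
`B1`, `B2 p` implies its `p`-slice: `b2_imp_descentAt`); bounded by the barriers
`Literature.Barriers.ResolutionOfSingularities.InseparableBaseChangeResolution`, `RegularNotGeometricallyRegular`,
`InseparableBaseChange`, `FrobeniusTwistResolution`. OURS, never a Literature fact; no literature tag (the earlier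
«Temkin2008, Question 3.3.3» tag was withdrawn on the lane-A reading, module docstring). [folklore] -/
def B2 (p : ℕ) : Prop := FgLevelRes p → ResolutionInChar.{0} p

/-- OURS, the `p`-slice of crux stmt-0549 (`descentPerfectToAll_iff`): perfect fields ⇒ all fields of characteristic
`p`. [folklore] -/
def DescentAt (p : ℕ) : Prop := PerfectRes p → ResolutionInChar.{0} p

/-- OURS, RUNG B as one `Prop`: the weak consequence-shape of the manuscript's embedded resolution over perfect fields
implies the summit conjunct `ResolutionInChar p` (all fields of characteristic `p`). [folklore] -/
def RungB (p : ℕ) : Prop := EmbeddedSmoothResPerfect p → ResolutionInChar.{0} p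

/-! ## Pure-logic assemblies and anchors -/

/-- The crux `DescentPerfectToAll` (stmt-ResolutionOfSingularities-0549, `Theses/Descent.lean`) is, verbatim, the
conjunction over primes of `DescentAt p = (PerfectRes p → ResolutionInChar p)`. [folklore] -/
theorem descentPerfectToAll_iff :
    Summit.ResolutionOfSingularities.ResolutionOfSingularities.Theses.Descent.DescentPerfectToAll ↔
      ∀ p : ℕ, p.Prime → DescentAt p :=
  Iff.rfl

/-- The summit conjunct at `p` contains `PerfectRes p` (specialise to perfect `k`). [folklore] -/
theorem perfectRes_of_resolutionInChar {p : ℕ} (h : ResolutionInChar.{0} p) : PerfectRes p :=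
  fun k _ _ _ X f a b c d => h k X f a b c d

/-- `PerfectRes p` contains `PrimeFieldRes p` (`ZMod p` is a perfect field). [folklore] -/
theorem primeFieldRes_of_perfectRes {p : ℕ} [Fact p.Prime] (h : PerfectRes p) : PrimeFieldRes p :=
  fun X f a b c d => h (ZMod p) X f a b c d

/-- **The glue is pure logic**: `B0`, `B1`, `B2` give `RungB`. [folklore] -/
theorem bridge (p : ℕ) [Fact p.Prime] (h0 : B0 p) (h1 : B1 p) (h2 : B2 p) : RungB p := by
  intro hE
  refine h2 (h1 fun X f hs hl hq hr => ?_)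
  exact h0 hE (ZMod p) X f hs hl hq hr

/-- `B0` and the `p`-slice of stmt-0549 already give `RungB` (the `B1`/`B2` split only isolates what is proved from
what is open). [folklore] -/
theorem rungB_of_b0_of_descentAt (p : ℕ) (h0 : B0 p) (hd : DescentAt p) : RungB p :=
  fun hE => hd (h0 hE)

/-- Given `B1` (proved idiom), the residual `B2 p` implies the `p`-slice of stmt-0549. [folklore] -/
theorem b2_imp_descentAt (p : ℕ) [Fact p.Prime] (h1 : B1 p) (h2 : B2 p) : DescentAt p :=
  fun hP => h2 (h1 (primeFieldRes_of_perfectRes hP))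

/-- **The whole chain from the typed candidate to the summit conjunct at `p`** (no step asserted: every link is a
hypothesis): G8-a glue, `B0`, `B1`, `B2` and the typed §1 claim over perfect `K` give `ResolutionInChar p`.
[folklore] -/
theorem resolutionInChar_of_hironakaERSPerfect (p : ℕ) [Fact p.Prime] (hA : ERSToEmbeddedSmoothRes p)
    (h0 : B0 p) (h1 : B1 p) (h2 : B2 p) (hH : HironakaERSPerfect p) : ResolutionInChar.{0} p :=
  bridge p h0 h1 h2 (hA hH)

/-- The same chain fed by the typed decl `S01Introduction.MainClaimPerfect` (all primes at once) and the crux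
stmt-0549 in place of `B1 ∧ B2`: typed §1 claim (perfect `K`) + G8-a glue + `B0` + `DescentPerfectToAll` ⇒
`ResolutionInChar p` for every prime `p`, i.e. the summit statement's conjuncts. [folklore] -/
theorem resolutionInChar_of_mainClaimPerfect
    (hH : Literature.AlgebraicGeometry.Hironaka2017.S01Introduction.MainClaimPerfect.{0})
    (hA : ∀ p : ℕ, p.Prime → ERSToEmbeddedSmoothRes p) (h0 : ∀ p : ℕ, p.Prime → B0 p)
    (hd : Summit.ResolutionOfSingularities.ResolutionOfSingularities.Theses.Descent.DescentPerfectToAll)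
    (p : ℕ) (hp : p.Prime) : ResolutionInChar.{0} p :=
  rungB_of_b0_of_descentAt p (h0 p hp) (hd p hp) (hA p hp (hH p hp))

/-! ## The «algebraic variety» (= `X` REDUCED) reading of the typed §1 claim (appended 2026-08-26)

The per-`p` slice `HironakaERSPerfect p` above quantifies over EVERY closed subscheme `X ⊂ Z` (ideal sheaf). The typed
sibling `Literature.AlgebraicGeometry.Hironaka2017.S01Introduction.MainClaimPerfectReduced` (= `U03_1_ours_red`, p458552)
is the READING «algebraic variety» = `X` REDUCED of the same printed sentence (plan/ADJUDICATION-PROTOCOL.md M4: one decl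
per reading); its per-`p` slice and the corresponding G8-a glue are recorded here so that the rung-B chain can also be
fed by that reading. Docstring revision 2026-08-26 (lane-B reading res-L1-ref-b2 18:47:57Z, adopted): an earlier sentence
here claiming that the unrestricted antecedent «is decided by a degenerate non-reduced instance» is WITHDRAWN — it was
the typer's unverified commentary (and misattributed res-adj-8's 16:32:32Z note, whose witness is over a non-perfect
`K`); as the lane observes, the typed `S01Introduction.IsERSSequence` lets a centre such as `V(x) ⊂ 𝔸¹` (a Cartier
divisor, blow-up = identity) remove the embedded component of `V(x²)` through the scheme-theoretic strict transform,
so nothing is prejudged here about the truth value of either antecedent. Nothing is asserted about the manuscript. -/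

/-- The per-`p` slice of the TYPED §1 candidate read with §2's perfect `K` AND «algebraic variety» = `X` reduced
(`S01Introduction.MainClaimPerfectReduced` = `U03_1_ours_red`; p.3 l.4–7 with p.4 l.22–24): for every perfect
field `K` of characteristic `p`, every smooth irreducible quasi-compact `Z → Spec K` and every REDUCED closed
subscheme `X ⊂ Z`, an ERS of `X ⊂ Z` exists. A CANDIDATE under adjudication, consumed only as a hypothesis.
[claim: Hironaka2017, status: under-review] -/
def HironakaERSPerfectReduced (p : ℕ) : Prop :=
  ∀ (K : Type) [Field K] [CharP K p] [PerfectField K]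
    (Z : Scheme.{0}) [IrreducibleSpace Z] (f : Z ⟶ Spec (.of K)) [Smooth f] [QuasiCompact f]
    (X : Z.IdealSheafData), IsReduced X.subscheme →
      Literature.AlgebraicGeometry.Hironaka2017.S01Introduction.HasERS f X

/-- The typed reduced-reading candidate is literally the conjunction over primes of its per-`p` slices.
[folklore] -/
theorem mainClaimPerfectReduced_iff :
    Literature.AlgebraicGeometry.Hironaka2017.S01Introduction.MainClaimPerfectReduced.{0} ↔
      ∀ p : ℕ, p.Prime → HironakaERSPerfectReduced p :=
  Iff.rfl

/-- The unrestricted slice implies the reduced one. [folklore] -/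
theorem hironakaERSPerfectReduced_of {p : ℕ} (h : HironakaERSPerfect p) : HironakaERSPerfectReduced p :=
  fun K _ _ _ Z _ f _ _ X _ => h K Z f X

/-- OURS, GAP row G8-a in the REDUCED reading: the typed §1 ERS claim over perfect `K` for reduced `X` implies
the non-embedded consequence-shape `EmbeddedSmoothResPerfect p` (whose `X` is integral, hence reduced): «the
composite of the blow-ups is proper (`Stacks02NS_holds`), an isomorphism over the generic point of the integral
`X` because every centre lies in the singular locus of a strict transform, and the regular final strict transform
is a resolution (`hasResolution_of_isEmbeddedTransform` pattern)». Expected provable from the tree; stated, not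
proved, here. It has the WEAKER antecedent of the two glue Props (reduced `X` only), hence is the easier one to prove
and implies `ERSToEmbeddedSmoothRes` (`ersToEmbeddedSmoothRes_of_red`); no claim is made here about the truth value of
either antecedent (docstring revision 2026-08-26, lane-B reading res-L1-ref-b2 18:47:57Z adopted: the earlier phrase
«the glue a non-vacuous chain should use» is withdrawn). [folklore] -/
def ERSToEmbeddedSmoothResRed (p : ℕ) : Prop := HironakaERSPerfectReduced p → EmbeddedSmoothResPerfect p

/-- The reduced-reading glue implies the unrestricted one (the unrestricted antecedent is stronger). [folklore] -/
theorem ersToEmbeddedSmoothRes_of_red {p : ℕ} (h : ERSToEmbeddedSmoothResRed p) : ERSToEmbeddedSmoothRes p :=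
  fun hH => h (hironakaERSPerfectReduced_of hH)

/-- **The chain from the reduced-reading typed candidate to the summit conjunct at `p`** (every link a
hypothesis): G8-a glue (reduced reading), `B0`, the `p`-slice of stmt-0549, and the typed §1 claim for reduced
`X` over perfect `K` give `ResolutionInChar p`. [folklore] -/
theorem resolutionInChar_of_hironakaERSPerfectReduced (p : ℕ) (hA : ERSToEmbeddedSmoothResRed p) (h0 : B0 p)
    (hd : DescentAt p) (hH : HironakaERSPerfectReduced p) : ResolutionInChar.{0} p :=
  rungB_of_b0_of_descentAt p h0 hd (hA hH)

/-- The same chain fed by the typed decl `S01Introduction.MainClaimPerfectReduced` (all primes at once) and the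
crux stmt-0549. [folklore] -/
theorem resolutionInChar_of_mainClaimPerfectReduced
    (hH : Literature.AlgebraicGeometry.Hironaka2017.S01Introduction.MainClaimPerfectReduced.{0})
    (hA : ∀ p : ℕ, p.Prime → ERSToEmbeddedSmoothResRed p) (h0 : ∀ p : ℕ, p.Prime → B0 p)
    (hd : Summit.ResolutionOfSingularities.ResolutionOfSingularities.Theses.Descent.DescentPerfectToAll)
    (p : ℕ) (hp : p.Prime) : ResolutionInChar.{0} p :=
  resolutionInChar_of_hironakaERSPerfectReduced p (hA p hp) (h0 p hp) (hd p hp) (hH p hp)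

end Summit.ResolutionOfSingularities.ResolutionOfSingularities.Theorems

end
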